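import Summits.BirchSwinnertonDyer.BirchSwinnertonDyer.Theorems.ErratumRoadFiveEulerHalfGenusFamilyLocalOrders
import Summits.BirchSwinnertonDyer.BirchSwinnertonDyer.Theorems.ClassRecordThreeCornerAtThreeShimuraFamilyTransverse
import HarnessLib

/-!
# ErratumRoadFive ∕ EulerHalf ∕ genus line — (b2b-κ) brick: TRANSVERSALITY of the genus-family classes on a served frame —
# clause (6) and the transverse half of clause (1) of `GenusClassDataSupply` (helper, `--supports 23444`)

Cell bsd-stepL, prover seat `bsd-stepL-imc-p1` g42; plan `HOME/imc-p1/g42/B2BK-ASSEMBLY-PLAN-imc-p1-g42.md` §3 (1), (6).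

WHAT.
* `localization_mem_iInf_transverseSubgroup_of_mem_transverseKer` — the local reading of Jetchev's global transverse kernel: if
  `x ∈ transverseKer W K ι n ℓ'` and `ℓ' ∈ w`, then `loc_w x ∈ ⨅_{w' ∣ w} H¹_tr(K[ℓ']_{w'})` (VERBATIM the `htr` step of corner3-p2's
  `ShimuraWalk.mem_selmerLocalKer_iff_mem_torsionLocalKer_of_mem_transverseKer`: `mem_transverseKer_iff` +
  `localization_mem_transverseSubgroup_iff`).
* `kolyvaginClass_familyData_mem_transverseKer_of_frameProfile` — on a served frame, the class `c_k(d)` of ANY family datum at a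
  square-free Zhang–Kolyvagin level `n` of index `≥ k ≥ 1` is transverse at every prime of `n` (corner3-p2's
  `ShimuraWalk.kolyvaginClass_familyData_mem_transverseKer` fed by adapter B) — the transverse half of clause (1) at `n = c`.
* `localization_kolyvaginClass_mem_transverse_of_frameProfile` — clause (6) VERBATIM: for `d′` at level `cℓ` and every place `w`,
  `loc_w c_k(d′) ∈ ⨅_{ℓ' ∣ c, ℓ' ∈ w} ⨅_{w' ∣ w} H¹_tr(K[ℓ']_{w'})`.

HONEST FRAMING: helper theorems; no crux and no stub is closed; BSD is proved for no curve.
[cite: Jetchev2008, §3.1.2 (p. 814), Prop. 4.6, Prop. 4.9] [cite: Howard2004HeegnerKolyvagin, Lemma 2.7.3] [cite: GrossLMS1991, §4 (4.4)]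
presearch: in-tree only; no new literature.
-/

set_option autoImplicit false
-- D-0017: single-problem summit, so `Summit.BirchSwinnertonDyer.BirchSwinnertonDyer.…` repeats a namespace BY DESIGN.
set_option linter.dupNamespace false

noncomputable section

open scoped Classical
open WeierstrassCurve NumberField Field IsDedekindDomain Literature.NumberTheory.EllipticCurves
  Literature.NumberTheory.EllipticCurves.ModularForms Literature.NumberTheory.GaloisRepresentations
  Literature.NumberTheory.GaloisRepresentations.DiscreteGaloisModule Literature.NumberTheory.EllipticCurves.Jetchev2008
  Literature.NumberTheory.Automorphic
  Summit.BirchSwinnertonDyer.Rank1Residual Summit.BirchSwinnertonDyer.Rank1Residual.X11b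
  Summit.BirchSwinnertonDyer.Rank1Residual.JET Summit.BirchSwinnertonDyer.Rank1Residual.JET.SelmerVocabulary

namespace Summit.BirchSwinnertonDyer.BirchSwinnertonDyer.Theorems.GenusLine

variable {W A : WeierstrassCurve ℚ} {p q : ℕ} {K : Type} [Field K] [NumberField K]

/-! ## §1 The local reading of the global transverse kernel -/

/-- **`x ∈ H¹_tr` globally at `ℓ'` ⟹ `loc_w x ∈ ⨅_{w' ∣ w} H¹_tr(K[ℓ']_{w'})` for `ℓ' ∈ w`** (corner3-p2's `htr` step, exported).
[cite: Jetchev2008, §3.1.2 (p. 814)] -/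
theorem localization_mem_iInf_transverseSubgroup_of_mem_transverseKer [W.IsElliptic]
    (ι : K →+* ℂ) {n : ℤ} {ℓ' : ℕ} [NumberField (ringClassField K ι ℓ')]
    (w : HeightOneSpectrum (𝓞 K)) (hw : (ℓ' : 𝓞 K) ∈ w.asIdeal)
    (x : galoisCohomology ((W.baseChange K).torsionGaloisModule n) 1) (hx : x ∈ transverseKer W K ι n ℓ') :
    galoisCohomology.localization ((W.baseChange K).torsionGaloisModule n) (Sum.inr w) 1 x ∈
      ⨅ (w' : HeightOneSpectrum (𝓞 (ringClassField K ι ℓ'))) (_ : w'.asIdeal.LiesOver w.asIdeal),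
        letI := (adicCompletionOfLiesOver K (ringClassField K ι ℓ') w w').toAlgebra
        transverseSubgroup (GaloisRep.toLocal w ((W.baseChange K).torsionGaloisModule n))
          (w'.adicCompletion (ringClassField K ι ℓ')) := by
  refine AddSubgroup.mem_iInf.mpr fun w' ↦ AddSubgroup.mem_iInf.mpr fun hw' ↦ ?_
  haveI : w'.asIdeal.LiesOver w.asIdeal := hw'
  have hℓw' : (ℓ' : 𝓞 (ringClassField K ι ℓ')) ∈ w'.asIdeal := by
    have h1 : (ℓ' : 𝓞 K) ∈ w'.asIdeal.under (𝓞 K) := hw'.over ▸ hw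
    rw [Ideal.under, Ideal.mem_comap, map_natCast] at h1
    exact h1
  exact (localization_mem_transverseSubgroup_iff ((W.baseChange K).torsionGaloisModule n) (ringClassField K ι ℓ') w w' x).mpr
    ((mem_transverseKer_iff W K ι n ℓ' x).mp hx w' hℓw')

/-! ## §2 Transversality of the family classes on a served frame -/

/-- **`c_k(d)` is transverse at every prime of its (Zhang–Kolyvagin) level on a served frame** (index `≥ k ≥ 1`): the transverse half
of clause (1) of `GenusClassDataSupply`. [cite: Jetchev2008, Prop. 4.6] [cite: Howard2004HeegnerKolyvagin, Lemma 2.7.3] -/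
theorem kolyvaginClass_familyData_mem_transverseKer_of_frameProfile [W.IsElliptic] [W.IsGloballyMinimal] [A.IsElliptic]
    [Fact p.Prime] [Fact q.Prime]
    (S : GenusHeegnerSettingRC W A p q K) (hprof : FrameProfile W A p q K) [∀ j : ℕ, NumberField (ringClassField K S.ιc j)]
    {k n : ℕ} (hk : 1 ≤ k) (hn : Squarefree n)
    (hKol : ∀ r ∈ n.primeFactors, Zhang2014.IsKolyvaginPrime (W.conductorNorm ℤ) W K p r)
    (hkn : (k : ℕ∞) ≤ Zhang2014.levelIndex W p n)
    (d : KolyvaginFamilyData W K S.ιc n) {ℓ' : ℕ} (hℓ' : ℓ' ∈ n.primeFactors) :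
    (d.kolyvaginClass (Fact.out : p.Prime) k :
      galoisCohomology ((W.baseChange K).torsionGaloisModule ((p ^ k : ℕ) : ℤ)) 1) ∈
      transverseKer W K S.ιc ((p ^ k : ℕ) : ℤ) ℓ' := by
  have hK : IsImaginaryQuadratic K := hprof.quad
  have hD : NumberField.discr K < -4 := GenusKolyvaginRC.discr_lt_neg_four_of_genus hK S.hd₁ S.hd₂ S.hd
  have hKolG := grossKolyvagin_level_of_frameProfile hprof hk hKol hkn
  have hKolN : ∀ r ∈ n.primeFactors, IsKolyvaginPrime (W.conductorNorm ℤ) W K p r := fun r hr ↦ (hKolG r hr).1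
  have hkM : (k : ℕ∞) ≤ ShimuraWalk.frobLevelIndex W K p n :=
    (ShimuraWalk.natCast_le_frobLevelIndex_iff hKolN k).mpr fun r hr ↦ (hKolG r hr).2
  exact ShimuraWalk.kolyvaginClass_familyData_mem_transverseKer W hK hD (p_ne_two_of_frameProfile hprof) S.ιc k hn hKolN hkM d hℓ'

/-- **Clause (6) of `GenusClassDataSupply` on a served frame**: for a family datum `d′` at the square-free Zhang–Kolyvagin level `c·ℓ`
(index `≥ k ≥ 1`) and every finite place `w` of `K`, `loc_w c_k(d′)` lies in the transverse condition of every `K[ℓ']_{w'}`, `ℓ' ∣ c`,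
`ℓ' ∈ w`, `w' ∣ w`. [cite: Jetchev2008, Prop. 4.9, §3.1.2] [cite: Howard2004HeegnerKolyvagin, Lemma 2.7.3] -/
theorem localization_kolyvaginClass_mem_transverse_of_frameProfile [W.IsElliptic] [W.IsGloballyMinimal] [A.IsElliptic]
    [Fact p.Prime] [Fact q.Prime]
    (S : GenusHeegnerSettingRC W A p q K) (hprof : FrameProfile W A p q K) [∀ j : ℕ, NumberField (ringClassField K S.ιc j)]
    {k c ℓ : ℕ} (hk : 1 ≤ k) (hcℓ : Squarefree (c * ℓ))
    (hKol : ∀ r ∈ (c * ℓ).primeFactors, Zhang2014.IsKolyvaginPrime (W.conductorNorm ℤ) W K p r)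
    (hkn : (k : ℕ∞) ≤ Zhang2014.levelIndex W p (c * ℓ))
    (d' : KolyvaginFamilyData W K S.ιc (c * ℓ)) (w : HeightOneSpectrum (𝓞 K)) :
    galoisCohomology.localization ((W.baseChange K).torsionGaloisModule ((p ^ k : ℕ) : ℤ)) (Sum.inr w) 1
        (d'.kolyvaginClass (Fact.out : p.Prime) k) ∈
      ⨅ ℓ' ∈ c.primeFactors.filter (fun ℓ' : ℕ ↦ ((ℓ' : ℕ) : 𝓞 K) ∈ w.asIdeal),
        ⨅ (w' : HeightOneSpectrum (𝓞 (ringClassField K S.ιc ℓ'))) (_ : w'.asIdeal.LiesOver w.asIdeal),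
          letI := (adicCompletionOfLiesOver K (ringClassField K S.ιc ℓ') w w').toAlgebra
          transverseSubgroup (GaloisRep.toLocal w ((W.baseChange K).torsionGaloisModule ((p ^ k : ℕ) : ℤ)))
            (w'.adicCompletion (ringClassField K S.ιc ℓ')) := by
  refine AddSubgroup.mem_iInf.mpr fun ℓ' ↦ AddSubgroup.mem_iInf.mpr fun hℓ' ↦ ?_
  rw [Finset.mem_filter] at hℓ'
  have hℓ'c : ℓ' ∈ (c * ℓ).primeFactors :=
    Nat.primeFactors_mono (dvd_mul_right c ℓ) hcℓ.ne_zero hℓ'.1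
  exact localization_mem_iInf_transverseSubgroup_of_mem_transverseKer S.ιc w hℓ'.2 _
    (kolyvaginClass_familyData_mem_transverseKer_of_frameProfile S hprof hk hcℓ hKol hkn d' hℓ'c)

end Summit.BirchSwinnertonDyer.BirchSwinnertonDyer.Theorems.GenusLine

end
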